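import Summits.NavierStokesRegularity.NavierStokesRegularity.Theses.CloudStretchingBudget
import Literature.Analysis.FluidPDE.AdaptedBackwardKernel

/-!
# `SubunitCloudStretching` (stmt-NavierStokesRegularity-18491) — birth skeleton `Lines/birth.lean`

Route `CloudStretchingBudget`, crux #2 (THE BET, joint J₃). For a classical Leray–Hopf solution
`u` on `ℝ³ × [0,T)` from a rapidly decaying datum with eventual Type-I rate
`√(T−t) ‖u(t)‖_∞ ≤ C √ν`, every terminal point `x₀` and every flow-ADAPTED backward kernel `G`
on `[t₀,T)` at `x₀` (adjoint equation `∂ₜG + u·∇G + νΔG = 0`, unit mass, concentration at `x₀`,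
two-sided Gaussian bounds): with `ω = curl u`, `ξ = ω/|ω|` (inline `‖ω‖⁻¹ • ω`),
`M(t) = ∫ ‖ω‖ G` (cloud mass), `Str(t₁,t₂) = ∫∫ ⟪∇u ξ, ξ⟫ ‖ω‖ G` (cloud stretching) and
`Dfc(t₁,t₂) = ∫∫ ‖ω‖ |∇ξ|²_F G` (direction-diffusion deficit, lower integral `.toReal`), there are
`δ ∈ (0,1]` and `t₁ ∈ [t₀,T)` with `Str − ν·Dfc ≤ (1−δ) ∫_{t₂}^{t₃} M(s)/(T−s) ds` on every window
`t₁ ≤ t₂ ≤ t₃ < T` — net cloud stretching stays below the self-similar clock.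

## The line: CONSTANTIN'S IDENTITY ON THE CLOUD · REGULAR TOP · SIGNED TERMS SUB-CLOCK AT A BLOW-UP

Write `vort u s x = curl (u s) x`, `dir u s x = ‖ω‖⁻¹ • ω` and the named cloud functionals
`cloudMass`, `cloudClock`, `cloudStretch`, `cloudDeficit` (these four are DEFINITIONALLY the
crux's inline `M`, `∫ M/(T−s)`, `Str`, `Dfc`), plus two more cloud functionals the line introduces:

* `cloudAmplitude u G t₁ t₂ = ∫∫ ‖u‖² ‖ω‖ G` (Type-I AMPLITUDE on the vortical cloud; lower
  integral, `.toReal`), and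
* `cloudTransfer u G t₁ t₂ = −∫∫ ⟪u, ξ⟫ · (∇G · ω)` (the SIGNED helicity-type TRANSFER term: the
  velocity component along the vorticity direction against the radial structure of the cloud).

Testing the stretching density against `G` and integrating by parts with `div ω = 0`
(Constantin's local identity `∫ (ξ·Sξ)|ω| φ = −∫ u·((ω·∇)ξ) φ − ∫ (u·ξ)(ω·∇φ)`, taken with
`φ = G(s,·)` on the open set `{ω ≠ 0}`; `(u·ξ)ω` is locally Lipschitz, so no boundary term on the
zero set) and AM–GM `|u||ω||∇ξ| ≤ aν |ω||∇ξ|² + (4aν)⁻¹ |u|²|ω|` gives, for every `a > 0`,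

  `Str ≤ a·ν·Dfc + (4aν)⁻¹·Amp + Xfer`                                   (S1, `stub_cloudConstantin`)

on every window on which `u` is (locally-in-time) bounded — provable, size M/L (integrability of
the three densities from the energy inequality, the Gaussian upper bound and an entropy/Bernstein
bound `∫∫ |∇G|²/G < ∞` for the adjoint equation with bounded drift; room ABOVE the window in time
is what the backward equation needs, hence the local-boundedness hypothesis on `[t₁, t']`, all
`t' < T`).

If `∇u` stays bounded near the top time (the REGULAR case), the crux's conclusion is immediate:
`Str ≤ K ∫ M ds ≤ K (T−t₂) · clock`, `−ν·Dfc ≤ 0`, so `δ = 1/2` works once `K(T−t₁) ≤ 1/2`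
                                                              (S2, `stub_subunit_of_gradientBound`)
— provable, size M (pure estimation + measurability bookkeeping; junk-safe: a non-integrable `Str`
is `0 ≤` the right-hand side).

At a GENUINE blow-up (`∇u` unbounded near `T`; Type-I by the rate clause) the line's bet is that
the two signed Constantin terms are sub-clock with the direction-diffusion credit `(1−a)ν·Dfc`:

  `∃ a > 0, δ ∈ (0,1], t₁: (4aν)⁻¹·Amp + Xfer ≤ (1−a)·ν·Dfc + (1−δ)·clock` on late windows
                                               (S3, `stub_signedCloudTermsSubcritical_of_blowup`)

— OPEN (it implies the crux at a blow-up; it is the crux strengthened by exactly the AM–GM slack).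
What it exposes: the amplitude term is AUTOMATICALLY perturbative in the rung constant,
`(4aν)⁻¹ Amp ≤ (C²/4a)·clock` from the Type-I clause alone, so S3 is a statement about ONE signed
scalar, the helicity-type transfer `Xfer = −∫∫ (u·ξ)(ω·∇G)`: a Type-I singularity violating the
crux must sustain velocity–vorticity ALIGNMENT correlated with the cloud gradient at clock
strength `≥ (1 − C²/4a)`·clock. For clouds ending at regular points (and for the exponentially
tilted far tails of a singular profile) all three terms are `o(clock)` (`Amp ≲ ‖u‖²_∞ (T−t)·clock`,
`Xfer = Str + ∫∫ u·((ω·∇)ξ) G ≲ (‖∇u‖_∞ + ‖u‖_∞⟨|∇ξ|⟩)(T−t)·clock`), so the content of S3 sits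
on clouds ending at singular points, where `AdaptedVorticityFloor` (J₁) puts the floor.

Composition `SubunitCloudStretching_of : CloudConstantin → SubunitOfGradientBound →
SignedCloudTermsSubcriticalOfBlowup → SubunitCloudStretching` (hypotheses written through the
reducible name-keyed aliases `__Registered.stub_*`; kernel-checked below, no `sorry` outside the
three `stub_*`): package the crux's five kernel clauses and the two-sided Gaussian
clause as `IsAdaptedBackwardKernel` / `IsGaussianComparable` (`isAdaptedBackwardKernel_iff`,
`isGaussianComparable_iff_fin_three`, verbatim), substitute the crux's `ω, ξ, M, Str, Dfc`
(definitional bridge to the named functionals), split on boundedness of `∇u` near `T`: regular →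
S2; singular → S3 gives `a, δ, t₁`, the Type-I clause gives a time `t⋆` after which
`‖u(s)‖_∞ ≤ C√ν/√(T−s)` (so `u` is bounded on every `[t₁', t']`, `t' < T`, for
`t₁' = max t₁ ((t⋆+T)/2)`), S1 applies on every late window, and the two inequalities add up to
`Str − ν·Dfc ≤ (1−δ)·clock` (`linarith`; the `a·ν·Dfc` terms cancel exactly).

Disproof used: none exists for this crux (`ledger crux ls stmt-NavierStokesRegularity-18491`: no
workfiles before this line, 2026-08-17). Evidence honoured: refuter crux-attack at birth (Zero.lean,
2026-08-17): the zero flow satisfies every hypothesis block and the conclusion with `δ = 1` — all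
three stubs hold trivially on it too (`ω ≡ 0` makes every cloud functional vanish; S3's blow-up
antecedent is false). Negatives index (`ledger negatives --problem NavierStokesRegularity`, 4
refuted statements: SymmetryModuliCount 4055, PerpetualPump 1832, AdiabaticEddy 1429, Blowup 0154) —
none concerns adapted kernels, cloud functionals or Kato/Constantin budgets.
-/

noncomputable section

-- the summit and its single problem share the name `NavierStokesRegularity` (D-0017 nested layout)
set_option linter.dupNamespace false

namespace Summit.NavierStokesRegularity.NavierStokesRegularity.Cruxes.SubunitCloudStretching.Birth

open Set Filter MeasureTheory Topology
open Literature.Analysis.FluidPDE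

/-! ## Cloud functionals (the first four are definitionally the crux's inline quantities) -/

/-- Vorticity `ω(s, x) = curl u(s, ·)(x)` of a time-dependent field. -/
def vort (u : ℝ → EuclideanSpace ℝ (Fin 3) → EuclideanSpace ℝ (Fin 3)) (s : ℝ)
    (x : EuclideanSpace ℝ (Fin 3)) : EuclideanSpace ℝ (Fin 3) :=
  curl (u s) x

/-- Vorticity direction `ξ = ‖ω‖⁻¹ • ω` (junk `0` on the zero set of `ω`, as in the crux; equal to
`vorticityDirection (ω s) x` by `rfl`). -/
def dir (u : ℝ → EuclideanSpace ℝ (Fin 3) → EuclideanSpace ℝ (Fin 3)) (s : ℝ)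
    (x : EuclideanSpace ℝ (Fin 3)) : EuclideanSpace ℝ (Fin 3) :=
  ‖vort u s x‖⁻¹ • vort u s x

/-- Cloud mass (adapted vorticity mass) `M(t) = ∫ ‖ω(t, x)‖ G(t, x) dx`. -/
def cloudMass (u : ℝ → EuclideanSpace ℝ (Fin 3) → EuclideanSpace ℝ (Fin 3))
    (G : ℝ → EuclideanSpace ℝ (Fin 3) → ℝ) (t : ℝ) : ℝ :=
  ∫ x, ‖vort u t x‖ * G t x

/-- The self-similar clock of the cloud on a window, `∫_{t₁}^{t₂} M(s)/(T−s) ds`. -/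
def cloudClock (T : ℝ) (u : ℝ → EuclideanSpace ℝ (Fin 3) → EuclideanSpace ℝ (Fin 3))
    (G : ℝ → EuclideanSpace ℝ (Fin 3) → ℝ) (t₁ t₂ : ℝ) : ℝ :=
  ∫ s in t₁..t₂, cloudMass u G s / (T - s)

/-- Cloud stretching `Str(t₁, t₂) = ∫_{t₁}^{t₂} ∫ ⟪∇u(s,x) ξ, ξ⟫ ‖ω‖ G dx ds`. -/
def cloudStretch (u : ℝ → EuclideanSpace ℝ (Fin 3) → EuclideanSpace ℝ (Fin 3))
    (G : ℝ → EuclideanSpace ℝ (Fin 3) → ℝ) (t₁ t₂ : ℝ) : ℝ :=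
  ∫ s in t₁..t₂, ∫ x, inner ℝ (fderiv ℝ (u s) x (dir u s x)) (dir u s x) * ‖vort u s x‖ * G s x

/-- Direction-diffusion deficit `Dfc(t₁, t₂) = ∫∫ ‖ω‖ |∇ξ|²_F G` (lower integral, `.toReal`). -/
def cloudDeficit (u : ℝ → EuclideanSpace ℝ (Fin 3) → EuclideanSpace ℝ (Fin 3))
    (G : ℝ → EuclideanSpace ℝ (Fin 3) → ℝ) (t₁ t₂ : ℝ) : ℝ :=
  (∫⁻ z in Set.Ioo t₁ t₂ ×ˢ Set.univ,
      ENNReal.ofReal (‖vort u z.1 z.2‖ * frobeniusNormSq (fderiv ℝ (dir u z.1) z.2) *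
        G z.1 z.2)).toReal

/-- NEW: Type-I amplitude on the vortical cloud, `Amp(t₁, t₂) = ∫∫ ‖u‖² ‖ω‖ G` (lower integral,
`.toReal`). -/
def cloudAmplitude (u : ℝ → EuclideanSpace ℝ (Fin 3) → EuclideanSpace ℝ (Fin 3))
    (G : ℝ → EuclideanSpace ℝ (Fin 3) → ℝ) (t₁ t₂ : ℝ) : ℝ :=
  (∫⁻ z in Set.Ioo t₁ t₂ ×ˢ Set.univ,
      ENNReal.ofReal (‖u z.1 z.2‖ ^ 2 * ‖vort u z.1 z.2‖ * G z.1 z.2)).toReal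

/-- NEW: the signed helicity-type transfer term of Constantin's identity on the cloud,
`Xfer(t₁, t₂) = −∫_{t₁}^{t₂} ∫ ⟪u, ξ⟫ (∇G · ω) dx ds` (Bochner; the line proves its integrand
integrable on bounded windows inside `stub_cloudConstantin`). -/
def cloudTransfer (u : ℝ → EuclideanSpace ℝ (Fin 3) → EuclideanSpace ℝ (Fin 3))
    (G : ℝ → EuclideanSpace ℝ (Fin 3) → ℝ) (t₁ t₂ : ℝ) : ℝ :=
  -(∫ s in t₁..t₂, ∫ x, inner ℝ (u s x) (dir u s x) * fderiv ℝ (G s) x (vort u s x))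

/-! ## The three statements of the line -/

/-- S1 (PROVABLE, M/L). **Constantin's identity on the cloud, with AM–GM.** For a classical
Leray–Hopf rapidly-decaying-datum solution on `[0,T)`, an adapted two-sided-Gaussian backward kernel
`G` on `[t₀,T)` at `x₀`, and a time `t₁ ∈ [t₀,T)` from which on `u` is bounded on every compact
`[t₁, t'] × ℝ³`, `t' < T`: for every `a > 0` and every window `t₁ ≤ t₂ ≤ t₃ < T`,
`Str(t₂,t₃) ≤ a·ν·Dfc(t₂,t₃) + (4aν)⁻¹·Amp(t₂,t₃) + Xfer(t₂,t₃)`.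
Mechanism: slice-wise `∫ ⟪∇u ξ, ξ⟫|ω| G = −∫ u·((ω·∇)ξ) G − ∫ (u·ξ)(ω·∇G)` (integration by parts of
the locally Lipschitz field `(u·ξ) ω G`, `div ω = 0`, the zero set of `ω` contributes nothing),
`|u·((ω·∇)ξ)| ≤ |u||ω||∇ξ|_F ≤ aν|ω||∇ξ|²_F + (4aν)⁻¹|u|²|ω|`, `G > 0`; integrability of all
densities on the window from `∫∫|∇u|² < ∞` (Leray–Hopf), `G ≤ C₁(T−t₃)^{-3/2}`, `∫ G = 1`,
`‖u‖ ≤ B` on `[t₂, t']` and `∫∫ |∇G|²/G < ∞` (entropy identity / Bernstein estimate for the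
backward equation `∂ₜG = −u·∇G − νΔG`, which needs the drift bounded slightly ABOVE the window —
hence boundedness on every `[t₁,t']`). -/
def CloudConstantin : Prop :=
  ∀ (ν T : ℝ), 0 < ν → 0 < T →
    ∀ (u : ℝ → EuclideanSpace ℝ (Fin 3) → EuclideanSpace ℝ (Fin 3))
      (p : ℝ → EuclideanSpace ℝ (Fin 3) → ℝ),
      IsClassicalNSSolutionOn (Set.Ico 0 T) ν 0 u p → IsLerayHopfOn T ν 0 (u 0) u →
        HasRapidSpatialDecay (u 0) →
        ∀ (x₀ : EuclideanSpace ℝ (Fin 3)) (t₀ : ℝ) (G : ℝ → EuclideanSpace ℝ (Fin 3) → ℝ),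
          t₀ ∈ Set.Ico 0 T → IsAdaptedBackwardKernel ν u (Set.Ico t₀ T) T x₀ G →
            IsGaussianComparable G (Set.Ico t₀ T) T x₀ →
            ∀ t₁ : ℝ, t₀ ≤ t₁ → t₁ < T →
              (∀ t' : ℝ, t' < T → ∃ B : ℝ, ∀ s ∈ Set.Icc t₁ t', ∀ x, ‖u s x‖ ≤ B) →
              ∀ a : ℝ, 0 < a → ∀ t₂ t₃ : ℝ, t₁ ≤ t₂ → t₂ ≤ t₃ → t₃ < T →
                cloudStretch u G t₂ t₃ ≤
                  a * ν * cloudDeficit u G t₂ t₃ + (4 * a * ν)⁻¹ * cloudAmplitude u G t₂ t₃ +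
                    cloudTransfer u G t₂ t₃

/-- S2 (PROVABLE, M). **Regular top: a bounded velocity gradient near `T` makes the net cloud
stretching sub-clock.** Same solution class and kernel; if `‖∇u(s, x)‖ ≤ K` on `(t', T) × ℝ³` for
some `t' < T`, the crux's conclusion holds at `(x₀, G)` (indeed with `δ = 1/2` and any
`t₁ ≥ max(t₀, t')` with `K (T − t₁) ≤ 1/2`): `Str(t₂,t₃) ≤ K ∫_{t₂}^{t₃} M ≤ K (T−t₂)·clock` since
`1 ≤ (T−t₂)/(T−s)` on the window, and `−ν·Dfc ≤ 0`. Bookkeeping: `M(s) < ∞` and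
`(s,x) ↦ ‖ω‖ G` integrable on the window from the energy inequality and the Gaussian upper bound;
if the Bochner integral `Str` is junk (`0`) the inequality still holds since the clock is `≥ 0`. -/
def SubunitOfGradientBound : Prop :=
  ∀ (ν T : ℝ), 0 < ν → 0 < T →
    ∀ (u : ℝ → EuclideanSpace ℝ (Fin 3) → EuclideanSpace ℝ (Fin 3))
      (p : ℝ → EuclideanSpace ℝ (Fin 3) → ℝ),
      IsClassicalNSSolutionOn (Set.Ico 0 T) ν 0 u p → IsLerayHopfOn T ν 0 (u 0) u →
        HasRapidSpatialDecay (u 0) →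
        (∃ t' : ℝ, t' < T ∧ ∃ K : ℝ, ∀ s ∈ Set.Ioo t' T, ∀ x, ‖fderiv ℝ (u s) x‖ ≤ K) →
        ∀ (x₀ : EuclideanSpace ℝ (Fin 3)) (t₀ : ℝ) (G : ℝ → EuclideanSpace ℝ (Fin 3) → ℝ),
          t₀ ∈ Set.Ico 0 T → IsAdaptedBackwardKernel ν u (Set.Ico t₀ T) T x₀ G →
            IsGaussianComparable G (Set.Ico t₀ T) T x₀ →
            ∃ δ : ℝ, 0 < δ ∧ δ ≤ 1 ∧ ∃ t₁ ∈ Set.Ico t₀ T, ∀ t₂ t₃ : ℝ, t₁ ≤ t₂ → t₂ ≤ t₃ → t₃ < T →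
              cloudStretch u G t₂ t₃ - ν * cloudDeficit u G t₂ t₃ ≤ (1 - δ) * cloudClock T u G t₂ t₃

/-- S3 (OPEN — the bet of the line, load-bearing). **At a genuine Type-I blow-up the two signed
Constantin terms are sub-clock, with the direction-diffusion credit.** Same class with the eventual
Type-I rate `√(T−t)‖u(t)‖_∞ ≤ C√ν`; if `∇u` is UNBOUNDED on `(t',T) × ℝ³` for every `t' < T` (a
singularity at `T`), then for every `x₀` and every adapted two-sided-Gaussian kernel `G` on `[t₀,T)`
at `x₀` there are `a > 0`, `δ ∈ (0,1]` and `t₁ ∈ [t₀,T)` with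
`(4aν)⁻¹·Amp(t₂,t₃) + Xfer(t₂,t₃) ≤ (1−a)·ν·Dfc(t₂,t₃) + (1−δ)·clock(t₂,t₃)` on every window
`t₁ ≤ t₂ ≤ t₃ < T`. With S1 this is the crux strengthened by the AM–GM slack; the amplitude part is
automatic from the rate clause (`(4aν)⁻¹ Amp ≤ (C²/4a)·clock`), so the content is the signed
transfer `Xfer = −∫∫ (u·ξ)(ω·∇G)`: blow-up must align velocity with vorticity against the cloud
gradient at clock strength. Why it might fail: exactly as the crux — a Type-I (discretely)
self-similar blow-up saturates the clock (period-average of net stretching `= 1`), and the AM–GM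
slack is an additional O(1) loss in the rung constant `C` (perturbative only for `C < 2` modulo the
transfer term). -/
def SignedCloudTermsSubcriticalOfBlowup : Prop :=
  ∀ C : ℝ, 0 < C → ∀ (ν T : ℝ), 0 < ν → 0 < T →
    ∀ (u : ℝ → EuclideanSpace ℝ (Fin 3) → EuclideanSpace ℝ (Fin 3))
      (p : ℝ → EuclideanSpace ℝ (Fin 3) → ℝ),
      IsClassicalNSSolutionOn (Set.Ico 0 T) ν 0 u p → IsLerayHopfOn T ν 0 (u 0) u →
        HasRapidSpatialDecay (u 0) →
        (∀ᶠ t in 𝓝[<] T, ∀ x, Real.sqrt (T - t) * ‖u t x‖ ≤ C * Real.sqrt ν) →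
        (¬ ∃ t' : ℝ, t' < T ∧ ∃ K : ℝ, ∀ s ∈ Set.Ioo t' T, ∀ x, ‖fderiv ℝ (u s) x‖ ≤ K) →
        ∀ (x₀ : EuclideanSpace ℝ (Fin 3)) (t₀ : ℝ) (G : ℝ → EuclideanSpace ℝ (Fin 3) → ℝ),
          t₀ ∈ Set.Ico 0 T → IsAdaptedBackwardKernel ν u (Set.Ico t₀ T) T x₀ G →
            IsGaussianComparable G (Set.Ico t₀ T) T x₀ →
            ∃ a : ℝ, 0 < a ∧ ∃ δ : ℝ, 0 < δ ∧ δ ≤ 1 ∧ ∃ t₁ ∈ Set.Ico t₀ T,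
              ∀ t₂ t₃ : ℝ, t₁ ≤ t₂ → t₂ ≤ t₃ → t₃ < T →
                (4 * a * ν)⁻¹ * cloudAmplitude u G t₂ t₃ + cloudTransfer u G t₂ t₃ ≤
                  (1 - a) * ν * cloudDeficit u G t₂ t₃ + (1 - δ) * cloudClock T u G t₂ t₃

/-! ## Stubs -/

/-- STUB 1 = S1 `CloudConstantin` (provable, M/L): Constantin's identity on the cloud + AM–GM. -/
theorem stub_cloudConstantin : CloudConstantin := by
  sorry

/-- STUB 2 = S2 `SubunitOfGradientBound` (provable, M): the regular-top case of the crux. -/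
theorem stub_subunit_of_gradientBound : SubunitOfGradientBound := by
  sorry

/-- STUB 3 = S3 `SignedCloudTermsSubcriticalOfBlowup` (OPEN, the bet; hardest): at a Type-I
blow-up the signed Constantin terms of the cloud are sub-clock. -/
theorem stub_signedCloudTermsSubcritical_of_blowup : SignedCloudTermsSubcriticalOfBlowup := by
  sorry

/-! ## Name-keyed aliases of the stub statements — the hypotheses of `SubunitCloudStretching_of`
(`#h21_check_skeleton` admits a `Prop` binder whose head constant is keyed by a declared stub name) -/
namespace __Registered

/-- Alias keyed by the registered stub name: the statement of `stub_cloudConstantin`. -/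
abbrev stub_cloudConstantin : Prop := CloudConstantin
/-- Alias keyed by the registered stub name: the statement of `stub_subunit_of_gradientBound`. -/
abbrev stub_subunit_of_gradientBound : Prop := SubunitOfGradientBound
/-- Alias keyed by the registered stub name: the statement of
`stub_signedCloudTermsSubcritical_of_blowup`. -/
abbrev stub_signedCloudTermsSubcritical_of_blowup : Prop := SignedCloudTermsSubcriticalOfBlowup

end __Registered

/-! ## Glue -/

/-- From the eventual Type-I rate: a time `t⋆ < T` and, for every later start `t₁ > t⋆`, uniform
bounds for `u` on every compact `[t₁, t'] × ℝ³`, `t' < T`. -/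
theorem typeI_local_bound {C ν T : ℝ} (hC : 0 < C)
    {u : ℝ → EuclideanSpace ℝ (Fin 3) → EuclideanSpace ℝ (Fin 3)}
    (hTI : ∀ᶠ t in 𝓝[<] T, ∀ x, Real.sqrt (T - t) * ‖u t x‖ ≤ C * Real.sqrt ν) :
    ∃ tstar : ℝ, tstar < T ∧ ∀ t₁ : ℝ, tstar < t₁ →
      ∀ t' : ℝ, t' < T → ∃ B : ℝ, ∀ s ∈ Set.Icc t₁ t', ∀ x, ‖u s x‖ ≤ B := by
  obtain ⟨tstar, htstar, hsub⟩ := mem_nhdsLT_iff_exists_Ioo_subset.1 hTI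
  refine ⟨tstar, htstar, fun t₁ ht₁ t' ht' => ?_⟩
  refine ⟨C * Real.sqrt ν / Real.sqrt (T - t'), fun s hs x => ?_⟩
  have hsI : s ∈ Set.Ioo tstar T := ⟨lt_of_lt_of_le ht₁ hs.1, lt_of_le_of_lt hs.2 ht'⟩
  have hle : Real.sqrt (T - s) * ‖u s x‖ ≤ C * Real.sqrt ν := hsub hsI x
  have hsq : 0 < Real.sqrt (T - s) := Real.sqrt_pos.mpr (sub_pos.mpr hsI.2)
  have hsq' : 0 < Real.sqrt (T - t') := Real.sqrt_pos.mpr (sub_pos.mpr ht')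
  have hCν : 0 ≤ C * Real.sqrt ν := mul_nonneg hC.le (Real.sqrt_nonneg _)
  have hux : ‖u s x‖ ≤ C * Real.sqrt ν / Real.sqrt (T - s) := by
    rw [le_div_iff₀ hsq]
    simpa [mul_comm] using hle
  have hmono : Real.sqrt (T - t') ≤ Real.sqrt (T - s) :=
    Real.sqrt_le_sqrt (by linarith [hs.2])
  exact hux.trans (div_le_div_of_nonneg_left hCν hsq' hmono)

/-- **The three stubs' statements imply the crux `SubunitCloudStretching`, concluded BY NAME.**
`S1 → S2 → S3 → SubunitCloudStretching` (hypotheses = the registered stubs' statements, keyed by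
stub name through the reducible `__Registered` aliases); the only `sorry`s of this file sit inside
the three `stub_*` declarations, which this theorem does NOT use. -/
theorem SubunitCloudStretching_of :
    __Registered.stub_cloudConstantin → __Registered.stub_subunit_of_gradientBound →
      __Registered.stub_signedCloudTermsSubcritical_of_blowup →
      _root_.Summit.NavierStokesRegularity.NavierStokesRegularity.Theses.CloudStretchingBudget.SubunitCloudStretching := by
  intro h1 h2 h3
  intro C hC ν T hν hT u p hcl hLH hdec hTI x₀ t₀ G ht₀ hker hgau ω ξ hω hξ M Str Dfc hM hStr hDfc
  have hK : IsAdaptedBackwardKernel ν u (Set.Ico t₀ T) T x₀ G := isAdaptedBackwardKernel_iff.mpr hker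
  have hGc : IsGaussianComparable G (Set.Ico t₀ T) T x₀ :=
    isGaussianComparable_iff_fin_three.mpr hgau
  subst hω hξ hM hStr hDfc
  -- definitional bridge from the crux's inline quantities to the named cloud functionals
  suffices H : ∃ δ : ℝ, 0 < δ ∧ δ ≤ 1 ∧ ∃ t₁ ∈ Set.Ico t₀ T, ∀ t₂ t₃ : ℝ,
      t₁ ≤ t₂ → t₂ ≤ t₃ → t₃ < T →
        cloudStretch u G t₂ t₃ - ν * cloudDeficit u G t₂ t₃ ≤ (1 - δ) * cloudClock T u G t₂ t₃ by
    exact H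
  by_cases hreg : ∃ t' : ℝ, t' < T ∧ ∃ K : ℝ, ∀ s ∈ Set.Ioo t' T, ∀ x, ‖fderiv ℝ (u s) x‖ ≤ K
  · -- regular top: S2
    exact h2 ν T hν hT u p hcl hLH hdec hreg x₀ t₀ G ht₀ hK hGc
  · -- genuine (Type-I) blow-up: S3 + S1 on late windows, added up
    obtain ⟨a, ha, δ, hδ, hδ1, t₁, ht₁, hbet⟩ :=
      h3 C hC ν T hν hT u p hcl hLH hdec hTI hreg x₀ t₀ G ht₀ hK hGc
    obtain ⟨tstar, htstar, hbdd⟩ := typeI_local_bound (ν := ν) hC hTI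
    have h1' : t₁ ≤ max t₁ ((tstar + T) / 2) := le_max_left _ _
    have h2' : tstar < max t₁ ((tstar + T) / 2) :=
      lt_of_lt_of_le (by linarith) (le_max_right _ _)
    have h3' : max t₁ ((tstar + T) / 2) < T := max_lt ht₁.2 (by linarith)
    have h0' : t₀ ≤ max t₁ ((tstar + T) / 2) := le_trans ht₁.1 h1'
    refine ⟨δ, hδ, hδ1, max t₁ ((tstar + T) / 2), ⟨h0', h3'⟩, fun t₂ t₃ h12 h23 h3T => ?_⟩
    have hS1 := h1 ν T hν hT u p hcl hLH hdec x₀ t₀ G ht₀ hK hGc (max t₁ ((tstar + T) / 2)) h0' h3'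
      (hbdd _ h2') a ha t₂ t₃ h12 h23 h3T
    have hS3 := hbet t₂ t₃ (le_trans h1' h12) h23 h3T
    linarith

/-- WIRING CHECK: the three sorried stubs compose to a closed term of the crux's type (modulo
their `sorry`s). Deliberately an `example` (no declaration a probe's `exact?` could pick up). -/
example :
    _root_.Summit.NavierStokesRegularity.NavierStokesRegularity.Theses.CloudStretchingBudget.SubunitCloudStretching :=
  SubunitCloudStretching_of stub_cloudConstantin stub_subunit_of_gradientBound
    stub_signedCloudTermsSubcritical_of_blowup

end Summit.NavierStokesRegularity.NavierStokesRegularity.Cruxes.SubunitCloudStretching.Birth
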